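import Literature.Probability.RandomPlanarGeometry.SAWPulledLargeForceExpansionZdIntegrality
import Literature.Probability.RandomPlanarGeometry.SAWPulledLargeForceExpansionZdEleventhOrder
import Literature.Probability.RandomPlanarGeometry.SAWPulledLargeForceExpansionZdNinthOrder
import Literature.Probability.RandomPlanarGeometry.SAWPulledLargeForceExpansionZdEighthOrder
import Literature.Probability.RandomPlanarGeometry.SAWPulledLargeForceExpansionZdSeventhOrder
import Literature.Probability.RandomPlanarGeometry.SAWPulledLargeForceExpansionZdSixthOrder
import Literature.Probability.RandomPlanarGeometry.SAWPulledLargeForceExpansionZdFifthOrder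
import Literature.Probability.RandomPlanarGeometry.SAWPulledLargeForceExpansionZdFourthOrder
import Literature.Probability.RandomPlanarGeometry.SAWPulledLargeForceExpansionZdThirdOrder
import Literature.Probability.RandomPlanarGeometry.SAWPulledLargeForceExpansionZdFirstOrder
import HarnessLib

/-!
# Pulled SAW on `ℤ^{d+1}` at large force: CONGRUENCES BETWEEN DIMENSIONS for the coefficients `c_k^{(d)}` —
# `4dd′(d − d′) ∣ d′·c_k^{(d)} − d·c_k^{(d′)}`, and the square lattice decides `4d ∣ c_k^{(d)}`

Topic `Literature/Probability/RandomPlanarGeometry` (continues `SAWPulledLargeForceExpansionZdIntegrality.lean`: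
`exists_int_polynomial_largeForceCoeffZd_eq_two_mul_mul`, `c_k^{(d)} = 2d·R_k(2d)` with `R_k ∈ ℤ[X]` for `k ≥ 1`; uses the planar values `c_k(ℤ²)`, `k ≤ 11`,
as certified by the every-`d` census files with STANDARD axioms — `largeForceCoeff_one_eq_two`, `…_two_eq_neg_two` (`…ZdFirstOrder`), `…_three_eq_six`, `…_four_eq`,
`…_five_eq`, `…_six_eq`, `…_seven_eq`, `…_eight_eq`, `…_nine_eq`, `…_ten_eq`, `largeForceCoeffZd_at_eleven_planar` (`…ZdThirdOrder` … `…ZdEleventhOrder`) — NOT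
`SAWPulledLargeForceExpansionCoefficients.largeForceCoeff_values`, whose tenth-order window certificate rests on a kernel-reflection axiom (edition 1 bounced on it);
and `largeForceCoeffZd_one` (`c_k^{(1)} = c_k(ℤ²)`)).

PRINTED CONTEXT (locators only). Janse van Rensburg–Whittington (2013) §3.2 Theorem 8 (`c₁^{(d)} = 2d`); Graham (2010) §4 (integrality device).
NOT IN PRINT (lane statements): an integer polynomial `R` has `a − b ∣ R(a) − R(b)`, so the structure theorem forces congruences between the
coefficients of DIFFERENT dimensions:

* ★★★ `dvd_sub_largeForceCoeffZd` — **`4·d·d′·(d − d′) ∣ d′·c_k^{(d)} − d·c_k^{(d′)}`** for every `k ≥ 1`, all `d, d′` (e.g. `c_k(ℤ³) ≡ 2c_k(ℤ²) (mod 8)`,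
  `c_k(ℤ⁴) ≡ 3c_k(ℤ²) (mod 24)`);
* ★★ `dvd_largeForceCoeffZd_sub_mul_largeForceCoeff` (`4d(d−1) ∣ c_k^{(d)} − d·c_k(ℤ²)`), `four_mul_dvd_largeForceCoeffZd_sub`
  (**`c_k^{(d)} ≡ d·c_k(ℤ²) (mod 4d)`**), `four_mul_dvd_largeForceCoeffZd_iff` (**`4d ∣ c_k^{(d)} ⟺ 4 ∣ c_k(ℤ²)`**, `d ≥ 1`: in all dimensions or in none);
* ★★ THE TABLE from the certified planar values: `four_mul_dvd_largeForceCoeffZd_of_mem` — **`4d ∣ c_k^{(d)}` for every `d`, `k ∈ {4, 6, 7, 8, 9, 11}`**;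
  `four_mul_dvd_largeForceCoeffZd_sub_two_mul_of_mem` — **`c_k^{(d)} ≡ 2d (mod 4d)` (`c_k^{(d)}/(2d)` odd) for every `d`, `k ∈ {1, 2, 3, 5, 10}`** — so the
  lane's guess «`4d ∣ c_k^{(d)}` for all `k ≥ 4`» is FALSE exactly at `k = 5, 10` (through `k = 11`), in every dimension at once.
[cite: JansevanRensburgWhittington2013, §3.2 Theorem 8 (arXiv v4 p. 11)] [cite: Graham2010, Section 4]

Provenance: lane «pcv-sawmu», a-p3 g25 (2026-08-28). EDITION 1b (planar values from the standard-axiom every-`d` files). PURE STD; no definitions.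
-/

noncomputable section

open Finset
open scoped BigOperators
open Literature.Probability.LatticeModels
open Literature.Probability.RandomPlanarGeometry.SAW

namespace Literature.Probability.RandomPlanarGeometry.SAW.Zd

/-! ## §7 Congruences between dimensions: `4dd′(d − d′) ∣ d′·c_k^{(d)} − d·c_k^{(d′)}` -/

section Congruence

/-- ★★★ **THE DIMENSION CONGRUENCE**: for every `k ≥ 1` and all `d, d′ ∈ ℕ`,
`4·d·d′·(d − d′)` divides `d′·c_k^{(d)} − d·c_k^{(d′)}` — since `c_k^{(d)} = 2d·R_k(2d)` with `R_k ∈ ℤ[X]` and `a − b ∣ R_k(a) − R_k(b)`.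
E.g. `c_k(ℤ³) ≡ 2·c_k(ℤ²) (mod 8)` and `c_k(ℤ⁴) ≡ 3·c_k(ℤ²) (mod 24)` for every `k ≥ 1`.
[cite: JansevanRensburgWhittington2013, §3.2 Theorem 8 (arXiv v4 p. 11)] [cite: Graham2010, Section 4] -/
theorem dvd_sub_largeForceCoeffZd {k : ℕ} (hk : 1 ≤ k) (d d' : ℕ) :
    (4 * (d : ℤ) * d' * ((d : ℤ) - d')) ∣ (d' : ℤ) * largeForceCoeffZd d k - (d : ℤ) * largeForceCoeffZd d' k := by
  obtain ⟨R, -, hR⟩ := exists_int_polynomial_largeForceCoeffZd_eq_two_mul_mul hk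
  obtain ⟨m, hm⟩ := Polynomial.sub_dvd_eval_sub (2 * (d : ℤ)) (2 * (d' : ℤ)) R
  rw [hR d, hR d']
  exact ⟨m, by linear_combination (2 * (d : ℤ) * d') * hm⟩

/-- ★★ AGAINST THE SQUARE LATTICE: `4d(d − 1) ∣ c_k^{(d)} − d·c_k(ℤ²)` for every `k ≥ 1` and every `d` (`c_k(ℤ²) = largeForceCoeff k = c_k^{(1)}`).
[cite: JansevanRensburgWhittington2013, §3.2 Theorem 8 (arXiv v4 p. 11)] -/
theorem dvd_largeForceCoeffZd_sub_mul_largeForceCoeff {k : ℕ} (hk : 1 ≤ k) (d : ℕ) :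
    (4 * (d : ℤ) * ((d : ℤ) - 1)) ∣ largeForceCoeffZd d k - (d : ℤ) * largeForceCoeff k := by
  obtain ⟨m, hm⟩ := dvd_sub_largeForceCoeffZd hk d 1
  rw [largeForceCoeffZd_one] at hm
  exact ⟨m, by push_cast at hm; linear_combination hm⟩

/-- ★★ **`c_k^{(d)} ≡ d·c_k(ℤ²) (mod 4d)`** for every `k ≥ 1` and every `d`: the planar coefficient decides every coefficient modulo `4d`.
[cite: JansevanRensburgWhittington2013, §3.2 Theorem 8 (arXiv v4 p. 11)] -/
theorem four_mul_dvd_largeForceCoeffZd_sub {k : ℕ} (hk : 1 ≤ k) (d : ℕ) :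
    (4 * (d : ℤ)) ∣ largeForceCoeffZd d k - (d : ℤ) * largeForceCoeff k :=
  (dvd_mul_right _ _).trans (dvd_largeForceCoeffZd_sub_mul_largeForceCoeff hk d)

/-- ★★ THE CRITERION: for `k ≥ 1` and `d ≥ 1`, `4d ∣ c_k^{(d)}` iff `4 ∣ c_k(ℤ²)` — so «`4d` divides `c_k^{(d)}`» holds in ALL dimensions or in NONE,
and the square lattice decides. [cite: JansevanRensburgWhittington2013, §3.2 Theorem 8 (arXiv v4 p. 11)] -/
theorem four_mul_dvd_largeForceCoeffZd_iff {k : ℕ} (hk : 1 ≤ k) {d : ℕ} (hd : 1 ≤ d) :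
    (4 * (d : ℤ)) ∣ largeForceCoeffZd d k ↔ (4 : ℤ) ∣ largeForceCoeff k := by
  have h := four_mul_dvd_largeForceCoeffZd_sub hk d
  have hd0 : (d : ℤ) ≠ 0 := by exact_mod_cast (show d ≠ 0 by omega)
  constructor
  · intro h4
    have h' : ((d : ℤ) * 4) ∣ (d : ℤ) * largeForceCoeff k := by
      have := dvd_sub h4 h
      rw [sub_sub_cancel] at this
      rwa [mul_comm] at this
    exact (mul_dvd_mul_iff_left hd0).1 h'
  · intro h4
    have h' : (4 * (d : ℤ)) ∣ (d : ℤ) * largeForceCoeff k := by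
      rw [mul_comm (4 : ℤ)]; exact mul_dvd_mul_left _ h4
    have := dvd_add h h'
    rwa [sub_add_cancel] at this

/-- From the planar value modulo `4`: `c_k(ℤ²) = r + 4q` gives `c_k^{(d)} ≡ d·r (mod 4d)` in every dimension.
[cite: JansevanRensburgWhittington2013, §3.2 Theorem 8 (arXiv v4 p. 11)] -/
private theorem four_mul_dvd_of_value_congr {k d : ℕ} {v r q : ℤ} (hk : 1 ≤ k) (hv : largeForceCoeff k = v) (hq : v = r + 4 * q) :
    (4 * (d : ℤ)) ∣ largeForceCoeffZd d k - (d : ℤ) * r := by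
  obtain ⟨m, hm⟩ := four_mul_dvd_largeForceCoeffZd_sub hk d
  rw [hv, hq] at hm
  exact ⟨m + q, by linear_combination hm⟩

/-- ★★ THE TABLE, I (planar values certified by the every-`d` census files, `c₄ = −20`, `c₆ = −284`, `c₇ = 1100`, `c₈ = −4188`, `c₉ = 15148`, `c₁₁ = 111428`, all `≡ 0 (mod 4)`):
**`4d ∣ c_k^{(d)}` for EVERY `d`, for `k ∈ {4, 6, 7, 8, 9, 11}`.** [cite: JansevanRensburgWhittington2013, §3.2 Theorem 8 (arXiv v4 p. 11)] -/
theorem four_mul_dvd_largeForceCoeffZd_of_mem (d : ℕ) {k : ℕ} (hk : k = 4 ∨ k = 6 ∨ k = 7 ∨ k = 8 ∨ k = 9 ∨ k = 11) :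
    (4 * (d : ℤ)) ∣ largeForceCoeffZd d k := by
  have h4 := largeForceCoeff_four_eq
  have h6 := largeForceCoeff_six_eq
  have h7 := largeForceCoeff_seven_eq
  have h8 := largeForceCoeff_eight_eq
  have h9 := largeForceCoeff_nine_eq
  have h11 := largeForceCoeffZd_at_eleven_planar.2
  have key : ∀ {v q : ℤ}, largeForceCoeff k = v → v = 0 + 4 * q → (4 * (d : ℤ)) ∣ largeForceCoeffZd d k := by
    intro v q hv hq
    simpa using four_mul_dvd_of_value_congr (d := d) (by omega) hv hq
  rcases hk with rfl | rfl | rfl | rfl | rfl | rfl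
  · exact key h4 (q := -5) (by norm_num)
  · exact key h6 (q := -71) (by norm_num)
  · exact key h7 (q := 275) (by norm_num)
  · exact key h8 (q := -1047) (by norm_num)
  · exact key h9 (q := 3787) (by norm_num)
  · exact key h11 (q := 27857) (by norm_num)

/-- ★★ THE TABLE, II (planar values `c₁ = 2`, `c₂ = −2`, `c₃ = 6`, `c₅ = 74`, `c₁₀ = −48674`, all `≡ 2 (mod 4)`): **`c_k^{(d)} ≡ 2d (mod 4d)` — i.e.
`c_k^{(d)}/(2d)` is ODD — in EVERY dimension, for `k ∈ {1, 2, 3, 5, 10}`** (so `4d ∤ c₅^{(d)}`, `4d ∤ c₁₀^{(d)}` for every `d ≥ 1`).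
[cite: JansevanRensburgWhittington2013, §3.2 Theorem 8 (arXiv v4 p. 11)] -/
theorem four_mul_dvd_largeForceCoeffZd_sub_two_mul_of_mem (d : ℕ) {k : ℕ} (hk : k = 1 ∨ k = 2 ∨ k = 3 ∨ k = 5 ∨ k = 10) :
    (4 * (d : ℤ)) ∣ largeForceCoeffZd d k - 2 * (d : ℤ) := by
  have h1 := largeForceCoeff_one_eq_two
  have h2 := largeForceCoeff_two_eq_neg_two
  have h3 := largeForceCoeff_three_eq_six
  have h5 := largeForceCoeff_five_eq
  have h10 := largeForceCoeff_ten_eq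
  have key : ∀ {v q : ℤ}, largeForceCoeff k = v → v = 2 + 4 * q → (4 * (d : ℤ)) ∣ largeForceCoeffZd d k - 2 * (d : ℤ) := by
    intro v q hv hq
    have := four_mul_dvd_of_value_congr (d := d) (by omega) hv hq
    rwa [mul_comm (d : ℤ) 2] at this
  rcases hk with rfl | rfl | rfl | rfl | rfl
  · exact key h1 (q := 0) (by norm_num)
  · exact key h2 (q := -1) (by norm_num)
  · exact key h3 (q := 1) (by norm_num)
  · exact key h5 (q := 18) (by norm_num)
  · exact key h10 (q := -12169) (by norm_num)

end Congruence

end Literature.Probability.RandomPlanarGeometry.SAW.Zd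

end
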